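import Summits.CriticalPhenomena.CardyFormulaZ2.Theorems.CardySelfRefinementSymmetryUpgradeRZhouDefs
import Summits.CriticalPhenomena.CardyFormulaZ2.Theorems.CardyComplexConeParafermionToSLESixFamiliesIicDefs
import Summits.CriticalPhenomena.CardyFormulaZ2.Theorems.CardyComplexConeEdgePrecompactHalfPlaneArmCubeRoot
import Summits.CriticalPhenomena.CardyFormulaZ2.Theorems.CardySelfRefinementSymmetryUpgradeRTouchDiagArmTwoSided
import Summits.CriticalPhenomena.CardyFormulaZ2.Theorems.CardyBoundaryCoulombGasHalfPlaneOneArmThird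
import Literature.Probability.Percolation.IkhlefPonsaingFirstPassageVertex
import HarnessLib

/-!
# Stub `stub_halfPlaneOneArm` of crux `CardySelfRefinement.SymmetryUpgradeR` (stmt-CriticalPhenomena-17239),
# line `zhou-rotation-split-audit` (S3): ASSESSMENT and the honest conditional form

The registered stub `stub_halfPlaneOneArm : HalfPlaneOneArm` is Zhou's input (10)
(arXiv:2409.03235 v6, attributed to Ikhlef–Ponsaing 2012): TWO-SIDED `n^{-1/3}` bounds, up to
constants, for the probability that the origin is joined inside the AXIS-PARALLEL half-box
`[-n, n] × [0, n]` to its outer boundary, for bond percolation on `ℤ²` at `p = 1/2`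
(`halfBoxArm n`). It is an open problem as a theorem; this helper file (`--supports`, it does NOT
prove the stub) records exactly where it sits in the tree.

* LOWER half. It is VERBATIM the named open statement `HalfPlaneOneArmLower` of
  `Theorems/CardyComplexConeParafermionToSLESixFamiliesIicDefs.lean` (registered stub
  `stub_halfPlaneOneArmLower` of cruxes stmt-11389 / stmt-10814, dead-certified there:
  `strictHalfPlaneOneArm_of_halfPlaneOneArmLower` shows it already implies the former crux
  `StrictHalfPlaneOneArm`, "`β₁⁺ < 1/2` on bond-`ℤ²`", for which no `ℤ²` estimate is in print):
  `halfPlaneOneArmLower_of_halfPlaneOneArm`.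
* UPPER half. The tree proves it CONDITIONALLY on the uniform inner envelope of the corner
  parafermionic observable (`UniformInnerEnvelope`, crux stmt-11387, open):
  `halfPlaneArm_cubeRoot_of_uniformInnerEnvelope`
  (`Theorems/CardyComplexConeEdgePrecompactHalfPlaneArmCubeRoot.lean`).
* Hence the honest conditional form of the stub with NAMED tree hypotheses:
  `halfPlaneOneArm_of_halfPlaneOneArmLower_of_uniformInnerEnvelope :
     HalfPlaneOneArmLower → UniformInnerEnvelope → HalfPlaneOneArm`.
* The stub implies the open crux `CardyBoundaryCoulombGas.HalfPlaneOneArmThird`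
  (stmt-CriticalPhenomena-5662, the LOG form `log π⁺(n) / log n → -1/3`):
  `halfPlaneOneArmThird_of_halfPlaneOneArm` — so S3 is at least as hard as that crux.
* What IS a theorem now: Ikhlef–Ponsaing's strip law is discharged in the tree
  (`Literature.Probability.Percolation.IkhlefPonsaingFirstPassage_holds`, 2026-08-17), so the
  DIAGONAL half-plane one-arm probability `π◇(n)` (half-plane `{v₀ + v₁ ≤ 1}`, diagonal distance `n`)
  obeys `c n^{-1/3} ≤ π◇(n) ≤ C n^{-1/3}` UNCONDITIONALLY (`diagHalfPlaneOneArm_twoSided`, from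
  `touchExponent_diagArmTwoSided`). The only missing piece for the axis-parallel event of the stub is
  an orientation transfer UP TO CONSTANTS (`π⁺ ≍ π◇`); the tree has it only at exponent level
  (`stub_rotationTransfer`: `(log π◇(n) - log π⁺(n)) / log n → 0` from DKKMO's rotation invariance of
  quad crossings), which loses a constant factor per scale and cannot give (10).

References: W. Zhou, arXiv:2409.03235 v6, eq. (10); Y. Ikhlef, A. K. Ponsaing, J. Stat. Phys. 149
(2012) 10–36, Prop. 4.7; S. Smirnov, W. Werner, Math. Res. Lett. 8 (2001), Thm. 3 (`β₁⁺ = 1/3` on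
site-`𝕋`, log form only); P. Nolin, EJP 13 (2008), §4.
-/

noncomputable section

namespace Summit.CriticalPhenomena.CardyFormulaZ2.Theorems.SymmetryUpgradeR.ZhouRotationSplitAudit

open MeasureTheory Filter Set
open scoped Topology
open Literature.Probability.LatticeModels Literature.Probability.Percolation
open Summit.CriticalPhenomena.CardyFormulaZ2.Cruxes.ParafermionToSLESixFamilies.IicTraceFluxPairing
  (HalfPlaneOneArmLower)
open Summit.CriticalPhenomena.CardyFormulaZ2.Cruxes.EdgePrecompact.QkzStripBoundaryArm
  (UniformInnerEnvelope halfPlaneArm_cubeRoot_of_uniformInnerEnvelope)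

/-! ## Assembly of the two halves -/

/-- **Two halves ⇒ the stub's statement.** An eventual lower bound `c n^{-1/3} ≤ π⁺(n)`
(`HalfPlaneOneArmLower`) and an upper bound `π⁺(n) ≤ C n^{-1/3}` for `n ≥ 1` give `HalfPlaneOneArm`
with the single constant `min c (max C 1)⁻¹`. [folklore] -/
theorem halfPlaneOneArm_of_lower_of_upper (hlow : HalfPlaneOneArmLower)
    (hup : ∃ C : ℝ, ∀ n : ℕ, 1 ≤ n →
      (bondPercolation (zdGraph 2) half).real (halfBoxArm n) ≤ C * (n : ℝ) ^ (-((1 : ℝ) / 3))) :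
    HalfPlaneOneArm := by
  obtain ⟨c, hc, hlow⟩ := hlow
  obtain ⟨C, hup⟩ := hup
  have hM : 0 < max C 1 := lt_of_lt_of_le one_pos (le_max_right _ _)
  have hm : 0 < min c (max C 1)⁻¹ := lt_min hc (inv_pos.2 hM)
  refine ⟨min c (max C 1)⁻¹, hm, ?_⟩
  filter_upwards [hlow, eventually_ge_atTop 1] with n hn hn1
  have hpow : 0 ≤ (n : ℝ) ^ (-((1 : ℝ) / 3)) := Real.rpow_nonneg (Nat.cast_nonneg n) _
  constructor
  · exact (mul_le_mul_of_nonneg_right (min_le_left _ _) hpow).trans hn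
  · have hle : max C 1 ≤ (min c (max C 1)⁻¹)⁻¹ := by
      rw [le_inv_comm₀ hM hm]
      exact min_le_right _ _
    calc (bondPercolation (zdGraph 2) half).real (halfBoxArm n)
        ≤ C * (n : ℝ) ^ (-((1 : ℝ) / 3)) := hup n hn1
      _ ≤ max C 1 * (n : ℝ) ^ (-((1 : ℝ) / 3)) := mul_le_mul_of_nonneg_right (le_max_left _ _) hpow
      _ ≤ (min c (max C 1)⁻¹)⁻¹ * (n : ℝ) ^ (-((1 : ℝ) / 3)) := mul_le_mul_of_nonneg_right hle hpow

/-- **The honest conditional form of the stub, on NAMED tree hypotheses.** The sharp half-plane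
one-arm lower bound `HalfPlaneOneArmLower` (open; registered stub of cruxes stmt-11389 / stmt-10814)
and the uniform inner envelope `UniformInnerEnvelope` of the corner parafermionic observable (open;
crux stmt-11387), the latter through the landed flux calibration
`halfPlaneArm_cubeRoot_of_uniformInnerEnvelope`, give Zhou's input (10). [folklore] -/
theorem halfPlaneOneArm_of_halfPlaneOneArmLower_of_uniformInnerEnvelope :
    HalfPlaneOneArmLower → UniformInnerEnvelope → HalfPlaneOneArm := by
  intro hlow hUIE
  refine halfPlaneOneArm_of_lower_of_upper hlow ?_
  obtain ⟨C, hC⟩ := halfPlaneArm_cubeRoot_of_uniformInnerEnvelope hUIE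
  refine ⟨C, fun n hn => ?_⟩
  have h := hC n hn
  rw [neg_div] at h
  exact h

/-! ## What the stub implies (hardness) -/

/-- The stub contains the open named statement `HalfPlaneOneArmLower` (its lower half). [folklore] -/
theorem halfPlaneOneArmLower_of_halfPlaneOneArm (h : HalfPlaneOneArm) : HalfPlaneOneArmLower := by
  obtain ⟨c, hc, h⟩ := h
  exact ⟨c, hc, h.mono fun n hn => hn.1⟩

/-- `(K + a log n) / log n → a` along the naturals (`K / log n → 0` is the tree's
`halfPlaneOneArmThird_tendsto_const_div_log`). [folklore] -/
theorem tendsto_const_add_mul_log_div_log (K a : ℝ) :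
    Tendsto (fun n : ℕ ↦ (K + a * Real.log n) / Real.log n) atTop (𝓝 a) := by
  have h := (halfPlaneOneArmThird_tendsto_const_div_log K).add (tendsto_const_nhds (x := a))
  rw [zero_add] at h
  refine h.congr' ?_
  filter_upwards [eventually_ge_atTop 2] with n hn
  have hn' : (2 : ℝ) ≤ n := by exact_mod_cast hn
  have hlog : Real.log n ≠ 0 := (Real.log_pos (by linarith)).ne'
  field_simp

/-- **The stub implies crux `HalfPlaneOneArmThird` (stmt-CriticalPhenomena-5662)**: two-sided
`n^{-1/3}` bounds up to constants force `log π⁺(n) / log n → -1/3` (take logarithms and divide by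
`log n → ∞`). So `stub_halfPlaneOneArm` is at least as hard as that open crux. [folklore] -/
theorem halfPlaneOneArmThird_of_halfPlaneOneArm (h : HalfPlaneOneArm) :
    Summit.CriticalPhenomena.CardyFormulaZ2.Theses.CardyBoundaryCoulombGas.HalfPlaneOneArmThird := by
  obtain ⟨c, hc, h⟩ := h
  show Tendsto (fun n : ℕ ↦
    Real.log ((bondPercolation (zdGraph 2) half).real (halfBoxArm n)) / Real.log n) atTop
    (𝓝 (-(1 / 3 : ℝ)))
  have hlo := tendsto_const_add_mul_log_div_log (Real.log c) (-(1 / 3 : ℝ))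
  have hhi := tendsto_const_add_mul_log_div_log (Real.log c⁻¹) (-(1 / 3 : ℝ))
  refine tendsto_of_tendsto_of_tendsto_of_le_of_le' hlo hhi ?_ ?_
  · filter_upwards [h, eventually_ge_atTop 2] with n hn hn2
    have hn' : (2 : ℝ) ≤ n := by exact_mod_cast hn2
    have hnpos : (0 : ℝ) < n := by linarith
    have hlog : 0 < Real.log n := Real.log_pos (by linarith)
    have hpow : 0 < (n : ℝ) ^ (-((1 : ℝ) / 3)) := Real.rpow_pos_of_pos hnpos _
    have hP : 0 < (bondPercolation (zdGraph 2) half).real (halfBoxArm n) :=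
      lt_of_lt_of_le (mul_pos hc hpow) hn.1
    refine div_le_div_of_nonneg_right ?_ hlog.le
    have := Real.log_le_log (mul_pos hc hpow) hn.1
    rwa [Real.log_mul hc.ne' hpow.ne', Real.log_rpow hnpos, show -((1 : ℝ) / 3) = -(1 / 3 : ℝ) by
      norm_num] at this
  · filter_upwards [h, eventually_ge_atTop 2] with n hn hn2
    have hn' : (2 : ℝ) ≤ n := by exact_mod_cast hn2
    have hnpos : (0 : ℝ) < n := by linarith
    have hlog : 0 < Real.log n := Real.log_pos (by linarith)
    have hpow : 0 < (n : ℝ) ^ (-((1 : ℝ) / 3)) := Real.rpow_pos_of_pos hnpos _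
    have hP : 0 < (bondPercolation (zdGraph 2) half).real (halfBoxArm n) :=
      lt_of_lt_of_le (mul_pos hc hpow) hn.1
    refine div_le_div_of_nonneg_right ?_ hlog.le
    have := Real.log_le_log hP hn.2
    rwa [Real.log_mul (inv_pos.2 hc).ne' hpow.ne', Real.log_rpow hnpos,
      show -((1 : ℝ) / 3) = -(1 / 3 : ℝ) by norm_num] at this

/-! ## What is unconditional: the diagonal orientation -/

/-- **Two-sided `n^{-1/3}` bounds for the DIAGONAL half-plane one-arm probability of bond-`ℤ²` at
`p = 1/2`, unconditionally.** In diagonal coordinates `s = v₀ + v₁`, `d = v₀ - v₁`: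
`c n^{-1/3} ≤ P_{1/2}[0 ↔ {s = -n} ∪ {d = ±n} inside {s ≤ 1, -n ≤ s, |d| ≤ n}] ≤ C n^{-1/3}` for all
`n ≥ 1` — `touchExponent_diagArmTwoSided` fed with the tree's theorem
`IkhlefPonsaingFirstPassage_holds` (Ikhlef–Ponsaing 2012, Prop. 4.7, discharged). The axis-parallel
statement of the stub differs from this by an orientation transfer up to constants, not in the tree
(only the exponent-level `stub_rotationTransfer`). [cite: IkhlefPonsaing2012, Prop. 4.7 and Prop. 4.9] -/
theorem diagHalfPlaneOneArm_twoSided : ∃ c C : ℝ, 0 < c ∧ ∀ n : ℕ, 1 ≤ n →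
    c * (n : ℝ) ^ (-(1 / 3 : ℝ)) ≤ (bondPercolation (zdGraph 2) half).real
      {ω | ∃ y : Site 2, (y 0 + y 1 = -(n : ℤ) ∨ y 0 - y 1 = (n : ℤ) ∨ y 0 - y 1 = -(n : ℤ)) ∧
        ω ∈ openConnIn {v : Site 2 | v 0 + v 1 ≤ 1 ∧ -(n : ℤ) ≤ v 0 + v 1 ∧
          -(n : ℤ) ≤ v 0 - v 1 ∧ v 0 - v 1 ≤ n} 0 y} ∧
    (bondPercolation (zdGraph 2) half).real
      {ω | ∃ y : Site 2, (y 0 + y 1 = -(n : ℤ) ∨ y 0 - y 1 = (n : ℤ) ∨ y 0 - y 1 = -(n : ℤ)) ∧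
        ω ∈ openConnIn {v : Site 2 | v 0 + v 1 ≤ 1 ∧ -(n : ℤ) ≤ v 0 + v 1 ∧
          -(n : ℤ) ≤ v 0 - v 1 ∧ v 0 - v 1 ≤ n} 0 y} ≤ C * (n : ℝ) ^ (-(1 / 3 : ℝ)) :=
  Summit.CriticalPhenomena.CardyFormulaZ2.Theorems.SymmetryUpgradeR.SwallowingSkeleton.touchExponent_diagArmTwoSided
    Literature.Probability.Percolation.IkhlefPonsaingFirstPassage_holds

end Summit.CriticalPhenomena.CardyFormulaZ2.Theorems.SymmetryUpgradeR.ZhouRotationSplitAudit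

end
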